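import Literature.NumberTheory.EllipticCurves.Szpiro
import Literature.NumberTheory.EllipticCurves.SzpiroLocalDataProofs
import Literature.NumberTheory.DiophantineGeometry.StrongHall
import HarnessLib

/-!
# Strong Hall ⟹ generalized Szpiro (Bombieri–Gubler, Theorem 12.5.12, (b) ⟹ (c))

Trunk: `DiophValNum` (family `abc`; companion proof file of
`Literature.NumberTheory.EllipticCurves.Szpiro`). Proves

* `Literature.NumberTheory.EllipticCurves.generalizedSzpiroBG_of_strongHall` — **B–G Theorem 12.5.12, (b) ⟹ (c)**: the strong
  Hall conjecture 12.5.3 (`Literature.NumberTheory.DiophantineGeometry.StrongHallConjecture`) implies the generalized Szpiro conjecture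
  12.5.11 (`Literature.NumberTheory.EllipticCurves.GeneralizedSzpiroConjectureBG`),

following the printed proof (pp. 432–433): for a global minimal equation write
`Γ = GCD (c₄³, c₆²) = Γ' g⁶` (`Literature.NumberTheory.EllipticCurves.exists_factorization_eq_div_six`), apply strong Hall to the
primitive solution `(c₄/g², c₆/g³, 1728Δ/g⁶)` of `x³ − y² = z` ((12.11) is Mathlib's
`WeierstrassCurve.c_relation`), bound `g ≪ rad (g)` by Corollary 12.5.7
(`WeierstrassCurve.not_pow_dvd_c₄_c₆_of_isMinimalAt{,_two,_three}` of `SzpiroMinimalityProofs` =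
Silverman AEC Ex. 8.21, `Literature.NumberTheory.EllipticCurves.factorization_gcd_le_of_not_pow_dvd`, `Literature.NumberTheory.EllipticCurves.dvd_mul_radical_of_factorization_le`), and
`rad (Δ) rad (g) ≤ 6 cond (E)` by 12.5.5/12.5.9 (a prime `p ≥ 5` dividing `c₄` and `c₆` is
additive, `f_p ≥ 2`: `WeierstrassCurve.two_le_conductorExponent_of_dvd_Δ_of_dvd_c₄`).

## Design notes

* The conductor is H21's `WeierstrassCurve.conductorNorm ℤ` (Ogg's formula and Tate's algorithm);
  all conductor properties used are the *discharged* facts collected in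
  `Literature.NumberTheory.EllipticCurves.SzpiroLocalDataProofs` — no named fact is assumed.
* `rad (g)` is used in place of B–G's `rad (Γ)` (`rad (g) ∣ rad (Γ)`), and
  `rad (1728Δ/g⁶) ≤ 1728 rad (Δ)`; the resulting explicit constant is
  `2 · 72⁶ · C(ε/3)³ · 10368^{6+ε}`.

## References

* E. Bombieri, W. Gubler, *Heights in Diophantine Geometry*, New Math. Monogr. 4, Cambridge Univ.
  Press 2006, 12.5.5–12.5.9, 12.5.11, Theorem 12.5.12, proof (b) ⟹ (c), pp. 427–433.
  [BombieriGubler2006]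
-/

noncomputable section

open UniqueFactorizationMonoid IsDedekindDomain Real

namespace Literature.NumberTheory.EllipticCurves

/-! ### Arithmetic preliminaries -/

/-- For `n ≠ 0` there is `g ≠ 0` with `v_p(g) = ⌊v_p(n)/6⌋` for all `p` (so that `g⁶` is the
largest sixth power dividing `n`): `g = ∏ p^{⌊v_p(n)/6⌋}`. B–G, proof of 12.5.12 (b) ⟹ (c):
"`Γ = Γ' g⁶` with `Γ'` sixth-power free". [folklore] -/
theorem exists_factorization_eq_div_six (n : ℕ) :
    ∃ g : ℕ, g ≠ 0 ∧ ∀ p : ℕ, g.factorization p = n.factorization p / 6 := by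
  classical
  set f : ℕ →₀ ℕ := Finsupp.mapRange (fun k ↦ k / 6) (by simp) n.factorization with hf
  have hprime : ∀ p ∈ f.support, p.Prime := fun p hp ↦
    Nat.prime_of_mem_primeFactors
      ((Nat.support_factorization n) ▸ Finsupp.support_mapRange hp)
  refine ⟨f.prod (· ^ ·), ?_, fun p ↦ ?_⟩
  · rw [Finsupp.prod, Finset.prod_ne_zero_iff]
    exact fun p hp ↦ pow_ne_zero _ (hprime p hp).ne_zero
  · rw [Nat.prod_pow_factorization_eq_self hprime, hf, Finsupp.mapRange_apply]

/-- Divisibility of an integer by a power of a natural number, prime by prime: if `c ≠ 0` and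
`m · v_p(g) ≤ v_p(|c|)` for all primes `p`, then `g ^ m ∣ c`. [folklore] -/
theorem pow_natCast_dvd_of_factorization_le {g m : ℕ} {c : ℤ} (hg : g ≠ 0) (hc : c ≠ 0)
    (h : ∀ p : ℕ, p.Prime → m * g.factorization p ≤ c.natAbs.factorization p) :
    (g : ℤ) ^ m ∣ c := by
  have hc' : c.natAbs ≠ 0 := Int.natAbs_ne_zero.mpr hc
  have hdvd : g ^ m ∣ c.natAbs := by
    rw [← Nat.factorization_le_iff_dvd (pow_ne_zero _ hg) hc', Nat.factorization_pow]
    intro p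
    by_cases hp : p.Prime
    · simpa using h p hp
    · simp [Nat.factorization_eq_zero_of_not_prime _ hp]
  exact_mod_cast Int.natCast_dvd.mpr hdvd

/-- A rational prime `p ≥ 5` does not divide `2^a 3^b`. [folklore] -/
theorem not_dvd_two_pow_mul_three_pow {p : ℕ} (hp : p.Prime) (h5 : 5 ≤ p) (a b : ℕ) :
    ¬ p ∣ 2 ^ a * 3 ^ b := by
  intro h
  rcases (Nat.Prime.dvd_mul hp).mp h with h | h
  · have := (Nat.prime_dvd_prime_iff_eq hp Nat.prime_two).mp (hp.dvd_of_dvd_pow h); omega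
  · have := (Nat.prime_dvd_prime_iff_eq hp Nat.prime_three).mp (hp.dvd_of_dvd_pow h); omega


/-- **B–G, proof of 12.5.12 (b) ⟹ (c), use of Corollary 12.5.7**: if at the prime `p` not both
`p^{e₄+4} ∣ c₄` and `p^{e₆+6} ∣ c₆`, then `v_p (GCD (c₄³, c₆²)) ≤ max (3e₄ + 9, 2e₆ + 10)`.
[cite: BombieriGubler2006, Thm. 12.5.12 (b) ⟹ (c)] -/
theorem factorization_gcd_le_of_not_pow_dvd {c₄ c₆ : ℤ} {p e₄ e₆ : ℕ} (hp : p.Prime)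
    (h : ¬ (p : ℤ) ^ (e₄ + 4) ∣ c₄ ∨ ¬ (p : ℤ) ^ (e₆ + 6) ∣ c₆) :
    (Int.gcd (c₄ ^ 3) (c₆ ^ 2)).factorization p ≤ max (3 * e₄ + 9) (2 * e₆ + 10) := by
  set Γ := Int.gcd (c₄ ^ 3) (c₆ ^ 2) with hΓ
  by_cases hΓ0 : Γ = 0
  · rw [hΓ0, Nat.factorization_zero, Finsupp.zero_apply]; exact Nat.zero_le _
  -- `v_p` of an integer through its absolute value
  have key : ∀ {c : ℤ} {k n : ℕ}, ¬ (p : ℤ) ^ k ∣ c → (Γ : ℤ) ∣ c ^ n →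
      Γ.factorization p ≤ n * (k - 1) := by
    intro c k n hk hdvd
    have hc : c ≠ 0 := by rintro rfl; exact hk (dvd_zero _)
    have hcn : c.natAbs ≠ 0 := Int.natAbs_ne_zero.mpr hc
    have hlt : c.natAbs.factorization p < k := by
      by_contra hle
      push Not at hle
      apply hk
      have : p ^ k ∣ c.natAbs := (hp.pow_dvd_iff_le_factorization hcn).mpr hle
      exact_mod_cast Int.natCast_dvd.mpr this
    have hdvd' : Γ ∣ c.natAbs ^ n := by
      rw [← Int.natAbs_pow]; exact Int.natCast_dvd.mp hdvd
    have hle := Nat.factorization_le_factorization_of_dvd_right hdvd' hΓ0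
      (pow_ne_zero _ hcn) (a := p)
    rw [Nat.factorization_pow] at hle
    simp only [Finsupp.smul_apply, smul_eq_mul] at hle
    calc Γ.factorization p ≤ n * c.natAbs.factorization p := hle
      _ ≤ n * (k - 1) := Nat.mul_le_mul_left _ (by omega)
  rcases h with h | h
  · have := key h (hΓ ▸ Int.gcd_dvd_left _ _)
    omega
  · have := key h (hΓ ▸ Int.gcd_dvd_right _ _)
    omega

/-- **B–G, proof of 12.5.12 (b) ⟹ (c)**: "By Corollary 12.5.7, we deduce `g ≪ rad(g)`": if
`v₂(g) ≤ 3`, `v₃(g) ≤ 2` and `v_p(g) ≤ 1` for `p ≥ 5`, then `g ∣ 72 · rad(g)`.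
[cite: BombieriGubler2006, Thm. 12.5.12 (b) ⟹ (c)] -/
theorem dvd_mul_radical_of_factorization_le {g : ℕ} (hg : g ≠ 0)
    (h : ∀ p : ℕ, p.Prime → g.factorization p ≤ if p = 2 then 3 else if p = 3 then 2 else 1) :
    g ∣ 72 * radical g := by
  have hr : radical g ≠ 0 := radical_ne_zero
  rw [← Nat.factorization_le_iff_dvd hg (mul_ne_zero (by norm_num) hr)]
  intro p
  by_cases hp : p.Prime
  swap
  · simp [Nat.factorization_eq_zero_of_not_prime _ hp]
  have h72 : (72 : ℕ).factorization p = (if p = 2 then 3 else 0) + (if p = 3 then 2 else 0) := by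
    rw [show (72 : ℕ) = 2 ^ 3 * 3 ^ 2 by norm_num, Nat.factorization_mul (by norm_num) (by norm_num),
      Finsupp.add_apply, Nat.Prime.factorization_pow Nat.prime_two,
      Nat.Prime.factorization_pow Nat.prime_three, Finsupp.single_apply, Finsupp.single_apply]
    simp only [eq_comm]
  rw [Nat.factorization_mul (by norm_num) hr, Finsupp.add_apply, h72,
    DiophantineGeometry.factorization_radical_apply hg hp]
  have hg' := h p hp
  have hdvd : p ∣ g ↔ 1 ≤ g.factorization p := hp.dvd_iff_one_le_factorization hg
  by_cases h2 : p = 2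
  · subst h2; simp only [if_true] at hg' ⊢; split_ifs <;> omega
  by_cases h3 : p = 3
  · subst h3; simp only [h2, if_true, if_false] at hg' ⊢
    split_ifs <;> omega
  simp only [h2, h3, if_false] at hg' ⊢
  split_ifs with hd
  · omega
  · rw [hdvd] at hd; omega


/-! ### Bombieri–Gubler, Theorem 12.5.12, (b) ⟹ (c) -/

open WeierstrassCurve Rat.HeightOneSpectrum in
/-- **Bombieri–Gubler, Theorem 12.5.12, (b) ⟹ (c)** (*Heights in Diophantine Geometry* (2006),
pp. 432–433): the strong Hall conjecture 12.5.3 implies the generalized Szpiro conjecture 12.5.11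
(`GeneralizedSzpiroConjectureBG`). Printed proof: for a global minimal Weierstrass equation let
`Γ := GCD (c₄³, c₆²) = Γ' g⁶` with `Γ'` sixth-power free; by (12.11) `1728 Δ/g⁶ = (c₄/g²)³ − (c₆/g³)²`
is a primitive solution, so strong Hall gives `max (|c₄|³, |c₆|²) ≪_ε g⁶ rad (Δ/g⁶)^{6+ε}`; by
Corollary 12.5.7 `g ≪ rad (g) ≤ rad (Γ)`, hence `max (|c₄|³, |c₆|²) ≪_ε (rad (Δ) rad (Γ))^{6+ε}`
(12.25); a prime `p ≠ 2, 3` dividing `c₄` and `c₆` is a prime of additive reduction, `f_p ≥ 2`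
(12.5.5, 12.5.9), so `rad (Δ) rad (Γ) ≤ 6 cond (E)`; finally `|Δ| ≤ (|c₄|³ + |c₆|²)/1728`. (Here
with `rad (g)` in place of `rad (Γ)`, `rad (1728Δ/g⁶) ≤ 1728 rad (Δ)`, and explicit constant
`2 · 72⁶ · C(ε/3)³ · 10368^{6+ε}`.) [cite: BombieriGubler2006, Thm. 12.5.12 (b) ⟹ (c)] -/
theorem generalizedSzpiroBG_of_strongHall (hH : DiophantineGeometry.StrongHallConjecture) :
    GeneralizedSzpiroConjectureBG := by
  intro ε' hε'
  obtain ⟨C₀, hC₀⟩ := hH (ε' / 3) (by positivity)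
  set C : ℝ := max C₀ 1 with hCdef
  have hC1 : 1 ≤ C := le_max_right _ _
  have hC0 : 0 < C := one_pos.trans_le hC1
  set e : ℝ := 6 + ε' with hedef
  have he0 : 0 ≤ e := by positivity
  set K : ℝ := 72 ^ 6 * C ^ 3 * (1728 * 6) ^ e with hKdef
  have hK0 : 0 ≤ K := by positivity
  refine ⟨2 * K, fun W₀ hE hmin ↦ ?_⟩
  haveI := hE
  set c₄ : ℤ := W₀.c₄ with hc₄
  set c₆ : ℤ := W₀.c₆ with hc₆
  set Δ : ℤ := W₀.Δ with hΔ
  have hΔ0 : Δ ≠ 0 := Δ_ne_zero_of_isElliptic_baseChange_int W₀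
  have hrel : 1728 * Δ = c₄ ^ 3 - c₆ ^ 2 := W₀.c_relation
  -- `Γ = GCD (c₄³, c₆²) = Γ' g⁶`
  set Γ : ℕ := Int.gcd (c₄ ^ 3) (c₆ ^ 2) with hΓdef
  have hΓ0 : Γ ≠ 0 := by
    intro h
    rw [hΓdef, Int.gcd_eq_zero_iff] at h
    apply hΔ0
    have : (1728 : ℤ) * Δ = 0 := by rw [hrel, h.1, h.2, sub_zero]
    simpa using this
  obtain ⟨g, hg0, hgfac⟩ := exists_factorization_eq_div_six Γ
  have hΓc₄ : (Γ : ℤ) ∣ c₄ ^ 3 := Int.gcd_dvd_left _ _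
  have hΓc₆ : (Γ : ℤ) ∣ c₆ ^ 2 := Int.gcd_dvd_right _ _
  -- `g² ∣ c₄`, `g³ ∣ c₆`
  have hfacΓ : ∀ {c : ℤ} {n : ℕ}, c ≠ 0 → (Γ : ℤ) ∣ c ^ n → ∀ p : ℕ, p.Prime →
      Γ.factorization p ≤ n * c.natAbs.factorization p := by
    intro c n hc hdvd p hp
    have hcn : c.natAbs ≠ 0 := Int.natAbs_ne_zero.mpr hc
    have hdvd' : Γ ∣ c.natAbs ^ n := by
      rw [← Int.natAbs_pow]; exact Int.natCast_dvd.mp hdvd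
    have hle := Nat.factorization_le_factorization_of_dvd_right hdvd' hΓ0
      (pow_ne_zero _ hcn) (a := p)
    rw [Nat.factorization_pow] at hle
    simpa using hle
  have hg2 : (g : ℤ) ^ 2 ∣ c₄ := by
    by_cases h0 : c₄ = 0
    · rw [h0]; exact dvd_zero _
    refine pow_natCast_dvd_of_factorization_le hg0 h0 fun p hp ↦ ?_
    have := hfacΓ h0 hΓc₄ p hp
    rw [hgfac]; omega
  have hg3 : (g : ℤ) ^ 3 ∣ c₆ := by
    by_cases h0 : c₆ = 0
    · rw [h0]; exact dvd_zero _
    refine pow_natCast_dvd_of_factorization_le hg0 h0 fun p hp ↦ ?_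
    have := hfacΓ h0 hΓc₆ p hp
    rw [hgfac]; omega
  obtain ⟨x, hx⟩ := hg2
  obtain ⟨y, hy⟩ := hg3
  set z : ℤ := x ^ 3 - y ^ 2 with hzdef
  have hg0' : (g : ℤ) ≠ 0 := by exact_mod_cast hg0
  have hgz : (g : ℤ) ^ 6 * z = 1728 * Δ := by rw [hrel, hx, hy, hzdef]; ring
  have hz0 : z ≠ 0 := by
    intro h
    rw [h, mul_zero] at hgz
    exact hΔ0 (by simpa using hgz.symm)
  -- primitivity of `(x, y, z)`
  have hΓ' : Γ = g ^ 6 * Int.gcd (x ^ 3) (y ^ 2) := by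
    rw [hΓdef, hx, hy, mul_pow, mul_pow, ← pow_mul, ← pow_mul, Int.gcd_mul_left,
      Int.natAbs_pow, Int.natAbs_natCast]
  have hprim : DiophantineGeometry.IsPrimitiveHallSolution x y z := by
    refine ⟨rfl, hz0, fun d hd ↦ ?_⟩
    set Γ₁ := Int.gcd (x ^ 3) (y ^ 2) with hΓ₁
    have hΓ₁0 : Γ₁ ≠ 0 := by
      intro h; exact hΓ0 (by rw [hΓ', h, mul_zero])
    by_contra hd1
    have hd0 : d ≠ 0 := by
      rintro rfl
      exact hΓ₁0 (Nat.eq_zero_of_zero_dvd (by simpa using hd))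
    obtain ⟨q, hq, hqd⟩ := Nat.exists_prime_and_dvd hd1
    have hq6 : q ^ 6 ∣ Γ₁ := dvd_trans (pow_dvd_pow_of_dvd hqd 6) hd
    have h6 : 6 ≤ Γ₁.factorization q := (hq.pow_dvd_iff_le_factorization hΓ₁0).mp hq6
    have hfac : Γ.factorization q = 6 * g.factorization q + Γ₁.factorization q := by
      rw [hΓ', Nat.factorization_mul (pow_ne_zero _ hg0) hΓ₁0, Nat.factorization_pow]
      simp
    have := hgfac q
    omega
  -- the strong Hall conjecture for `(x, y, z)`
  obtain ⟨hHx, hHy⟩ := hC₀ x y z hprim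
  set Rz : ℝ := ((radical z.natAbs : ℕ) : ℝ) with hRz
  have hRz0 : 0 ≤ Rz := by positivity
  have hHx' : |(x : ℝ)| ≤ C * Rz ^ (2 + ε' / 3) :=
    hHx.trans (mul_le_mul_of_nonneg_right (le_max_left _ _) (by positivity))
  have hHy' : |(y : ℝ)| ≤ C * Rz ^ (3 + ε' / 3) :=
    hHy.trans (mul_le_mul_of_nonneg_right (le_max_left _ _) (by positivity))
  -- the radicals: `rad (z) ≤ 1728 rad (Δ)`, `g ≤ 72 rad (g)`, `rad (g) rad (Δ) ≤ 6 N`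
  set N : ℕ := (W₀.baseChange ℚ).conductorNorm ℤ with hNdef
  have hN0 : N ≠ 0 := (conductorNorm_pos_holds (W₀.baseChange ℚ)).ne'
  have hradz : radical z.natAbs ≤ 1728 * radical Δ.natAbs := by
    have hz' : z.natAbs ∣ 1728 * Δ.natAbs := by
      have : z ∣ 1728 * Δ := ⟨(g : ℤ) ^ 6, by rw [← hgz]; ring⟩
      simpa [Int.natAbs_mul] using Int.natAbs_dvd_natAbs.mpr this
    have h1 : radical z.natAbs ∣ radical 1728 * radical Δ.natAbs :=
      (radical_dvd_radical hz' (mul_ne_zero (by norm_num) (Int.natAbs_ne_zero.mpr hΔ0))).trans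
        radical_mul_dvd
    refine (Nat.le_of_dvd (by positivity) h1).trans ?_
    exact Nat.mul_le_mul_right _ (Nat.radical_le_self_iff.mpr (by norm_num))
  -- place above a rational prime, and the local data `48 = p^{e₄} w₄`, `864 = p^{e₆} w₆`
  have place : ∀ {p : ℕ} (hp : p.Prime), ∃ v : HeightOneSpectrum ℤ, natGenerator v = p :=
    fun {p} hp ↦ ⟨(primesEquiv (R := ℤ)).symm ⟨p, hp⟩, Literature.NumberTheory.EllipticCurves.Rat.natGenerator_primesEquiv_symm ⟨p, hp⟩⟩
  -- Corollary 12.5.7 ⟹ `v_p (g) ≤ 3, 2, 1`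
  have hgle : ∀ p : ℕ, p.Prime → g.factorization p ≤ if p = 2 then 3 else if p = 3 then 2 else 1 := by
    intro p hp
    obtain ⟨v, hv⟩ := place hp
    -- Corollary 12.5.7 (= Silverman AEC Ex. 8.21, `SzpiroMinimalityProofs`)
    have cor : ∀ {e₄ e₆ : ℕ}, ¬ ((p : ℤ) ^ (e₄ + 4) ∣ c₄ ∧ (p : ℤ) ^ (e₆ + 6) ∣ c₆) →
        Γ.factorization p ≤ max (3 * e₄ + 9) (2 * e₆ + 10) :=
      fun h ↦ factorization_gcd_le_of_not_pow_dvd (c₄ := c₄) (c₆ := c₆) hp (not_and_or.mp h)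
    rw [hgfac]
    by_cases h2 : p = 2
    · subst h2
      have := cor (e₄ := 4) (e₆ := 5) (not_pow_dvd_c₄_c₆_of_isMinimalAt_two v W₀ hΔ0 (hmin v) hv)
      rw [if_pos rfl]; omega
    by_cases h3 : p = 3
    · subst h3
      have := cor (e₄ := 1) (e₆ := 3) (not_pow_dvd_c₄_c₆_of_isMinimalAt_three v W₀ hΔ0 (hmin v) hv)
      rw [if_neg h2, if_pos rfl]; omega
    · have h5 : 5 ≤ p := by
        have := hp.two_le
        by_contra h; interval_cases p <;> first | exact absurd hp (by decide) | omega
      have := cor (e₄ := 0) (e₆ := 0)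
        (by simpa only [hv] using not_pow_dvd_c₄_c₆_of_isMinimalAt v W₀ hΔ0 (hmin v) (hv ▸ h5))
      rw [if_neg h2, if_neg h3]; omega
  have hg72 : g ≤ 72 * radical g :=
    Nat.le_of_dvd (by positivity) (dvd_mul_radical_of_factorization_le hg0 hgle)
  -- `rad (g) rad (Δ) ∣ 6 N` (12.5.5, 12.5.9)
  have hradN : radical g * radical Δ.natAbs ∣ 6 * N := by
    have hΔn : Δ.natAbs ≠ 0 := Int.natAbs_ne_zero.mpr hΔ0
    have hrg : radical g ≠ 0 := radical_ne_zero
    have hrΔ : radical Δ.natAbs ≠ 0 := radical_ne_zero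
    rw [← Nat.factorization_le_iff_dvd (mul_ne_zero hrg hrΔ) (mul_ne_zero (by norm_num) hN0)]
    intro p
    by_cases hp : p.Prime
    swap
    · simp [Nat.factorization_eq_zero_of_not_prime _ hp]
    obtain ⟨v, hv⟩ := place hp
    have hfN : N.factorization p = (W₀.baseChange ℚ).conductorExponent v := by
      rw [hNdef, ← hv]; exact factorization_conductorNorm_holds (W₀.baseChange ℚ) v
    rw [Nat.factorization_mul hrg hrΔ, Nat.factorization_mul (by norm_num) hN0, Finsupp.add_apply,
      Finsupp.add_apply, DiophantineGeometry.factorization_radical_apply hg0 hp, DiophantineGeometry.factorization_radical_apply hΔn hp, hfN]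
    -- `p ∣ Δ ⟹ f_p ≥ 1`
    have hbad : p ∣ Δ.natAbs → 1 ≤ (W₀.baseChange ℚ).conductorExponent v := by
      intro h
      have := conductorExponent_ne_zero_of_dvd_Δ (hmin v) (hv ▸ Int.natCast_dvd.mpr h)
      omega
    by_cases h23 : p = 2 ∨ p = 3
    · -- at `2` and `3` the factor `6` absorbs `rad (g)`
      have h6 : 1 ≤ (6 : ℕ).factorization p := by
        rcases h23 with rfl | rfl
        · rw [show (6 : ℕ) = 2 ^ 1 * 3 by norm_num, Nat.factorization_mul (by norm_num) (by norm_num),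
            Finsupp.add_apply, Nat.Prime.factorization_pow Nat.prime_two, Finsupp.single_eq_same]
          omega
        · rw [show (6 : ℕ) = 2 * 3 ^ 1 by norm_num, Nat.factorization_mul (by norm_num) (by norm_num),
            Finsupp.add_apply, Nat.Prime.factorization_pow Nat.prime_three, Finsupp.single_eq_same]
          omega
      split_ifs with hdg hdΔ hdΔ
      · have := hbad hdΔ; omega
      · omega
      · have := hbad hdΔ; omega
      · omega
    · push Not at h23
      have h5 : 5 ≤ p := by
        have := hp.two_le
        by_contra h; interval_cases p <;> first | exact absurd hp (by decide) | omega
      -- `p ∣ g ⟹ p ∣ c₄, p ∣ c₆ ⟹ p ∣ Δ`, additive reduction, `f_p ≥ 2`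
      have hpg : p ∣ g → 2 ≤ (W₀.baseChange ℚ).conductorExponent v := by
        intro hdvd
        have h1 : 1 ≤ g.factorization p := (hp.dvd_iff_one_le_factorization hg0).mp hdvd
        have hΓ6 : 6 ≤ Γ.factorization p := by have := hgfac p; omega
        have hpΓ : (p : ℤ) ∣ Γ :=
          Int.natCast_dvd_natCast.mpr ((hp.dvd_iff_one_le_factorization hΓ0).mpr (by omega))
        have hpint : Prime (p : ℤ) := Nat.prime_iff_prime_int.mp hp
        have hpc₄ : (p : ℤ) ∣ c₄ := hpint.dvd_of_dvd_pow (hpΓ.trans hΓc₄)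
        have hpc₆ : (p : ℤ) ∣ c₆ := hpint.dvd_of_dvd_pow (hpΓ.trans hΓc₆)
        have hpΔ : (p : ℤ) ∣ Δ := by
          have h1728 : (p : ℤ) ∣ 1728 * Δ := by
            rw [hrel]; exact dvd_sub (dvd_pow hpc₄ three_ne_zero) (dvd_pow hpc₆ two_ne_zero)
          rcases Int.Prime.dvd_mul hp h1728 with h | h
          · exact absurd h (by
              simpa using not_dvd_two_pow_mul_three_pow hp h5 6 3)
          · exact Int.natCast_dvd.mpr h
        exact two_le_conductorExponent_of_dvd_Δ_of_dvd_c₄ (hmin v) (hv ▸ hpΔ) (hv ▸ hpc₄)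
      have h6 : (6 : ℕ).factorization p = 0 := by
        apply Nat.factorization_eq_zero_of_not_dvd
        simpa using not_dvd_two_pow_mul_three_pow hp h5 1 1
      rw [h6, zero_add]
      split_ifs with hdg hdΔ hdΔ
      · have := hpg hdg; omega
      · have := hpg hdg; omega
      · exact hbad hdΔ
      · exact Nat.zero_le _
  -- real numbers
  set Rg : ℝ := ((radical g : ℕ) : ℝ) with hRg
  set RΔ : ℝ := ((radical Δ.natAbs : ℕ) : ℝ) with hRΔ
  set N' : ℝ := ((N : ℕ) : ℝ) with hN'
  have hRg1 : 1 ≤ Rg := by rw [hRg]; exact_mod_cast Nat.radical_pos g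
  have hRΔ1 : 1 ≤ RΔ := by rw [hRΔ]; exact_mod_cast Nat.radical_pos _
  have hRzle : Rz ≤ 1728 * RΔ := by rw [hRz, hRΔ]; exact_mod_cast hradz
  have hgle' : (g : ℝ) ≤ 72 * Rg := by rw [hRg]; exact_mod_cast hg72
  have hB : Rg * RΔ ≤ 6 * N' := by
    have h := Nat.le_of_dvd (by positivity) hradN
    rw [hRg, hRΔ, hN']
    exact_mod_cast h
  have h6e : (6 : ℝ) ≤ e := by rw [hedef]; linarith
  have hg6 : (g : ℝ) ^ 6 ≤ 72 ^ 6 * Rg ^ e := by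
    calc (g : ℝ) ^ 6 ≤ (72 * Rg) ^ 6 := pow_le_pow_left₀ (by positivity) hgle' 6
      _ = 72 ^ 6 * Rg ^ ((6 : ℕ) : ℝ) := by rw [mul_pow, Real.rpow_natCast]
      _ ≤ 72 ^ 6 * Rg ^ e :=
        mul_le_mul_of_nonneg_left (Real.rpow_le_rpow_of_exponent_le hRg1 (by exact_mod_cast h6e))
          (by positivity)
  -- the common estimate for `|c₄|³ = g⁶ |x|³` and `|c₆|² = g⁶ |y|²`
  have hRz1 : 1 ≤ Rz := by rw [hRz]; exact_mod_cast Nat.radical_pos _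
  have key : ∀ (u : ℝ) (k : ℕ) (s : ℝ), 0 ≤ u → u ≤ C * Rz ^ s → (k : ℝ) * s ≤ e → k ≤ 3 →
      (g : ℝ) ^ 6 * u ^ k ≤ K * N' ^ e := by
    intro u k s hu0 hu hks hk3
    have h1 : u ^ k ≤ C ^ 3 * (1728 * RΔ) ^ e := by
      calc u ^ k ≤ (C * Rz ^ s) ^ k := pow_le_pow_left₀ hu0 hu k
        _ = C ^ k * Rz ^ ((k : ℝ) * s) := by
          rw [mul_pow, ← Real.rpow_natCast (Rz ^ s) k, ← Real.rpow_mul hRz0, mul_comm s]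
        _ ≤ C ^ 3 * Rz ^ e :=
          mul_le_mul (pow_le_pow_right₀ hC1 hk3) (Real.rpow_le_rpow_of_exponent_le hRz1 hks)
            (by positivity) (by positivity)
        _ ≤ C ^ 3 * (1728 * RΔ) ^ e :=
          mul_le_mul_of_nonneg_left (Real.rpow_le_rpow hRz0 hRzle he0) (by positivity)
    calc (g : ℝ) ^ 6 * u ^ k ≤ (72 ^ 6 * Rg ^ e) * (C ^ 3 * (1728 * RΔ) ^ e) :=
          mul_le_mul hg6 h1 (by positivity) (by positivity)
      _ = 72 ^ 6 * C ^ 3 * 1728 ^ e * (Rg * RΔ) ^ e := by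
          rw [Real.mul_rpow (by norm_num) (by positivity), Real.mul_rpow (by positivity) (by positivity)]
          ring
      _ ≤ 72 ^ 6 * C ^ 3 * 1728 ^ e * (6 * N') ^ e :=
          mul_le_mul_of_nonneg_left (Real.rpow_le_rpow (by positivity) hB he0) (by positivity)
      _ = K * N' ^ e := by
          rw [hKdef, Real.mul_rpow (by norm_num) (by positivity),
            Real.mul_rpow (by norm_num) (by norm_num)]
          ring
  have hc₄3 : |(c₄ : ℝ)| ^ 3 ≤ K * N' ^ e := by
    have h : |(c₄ : ℝ)| ^ 3 = (g : ℝ) ^ 6 * |(x : ℝ)| ^ 3 := by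
      rw [hx]; push_cast
      rw [abs_mul, abs_of_nonneg (by positivity : (0 : ℝ) ≤ (g : ℝ) ^ 2)]; ring
    rw [h]
    exact key _ 3 _ (abs_nonneg _) hHx' (by rw [hedef]; push_cast; linarith) le_rfl
  have hc₆2 : |(c₆ : ℝ)| ^ 2 ≤ K * N' ^ e := by
    have h : |(c₆ : ℝ)| ^ 2 = (g : ℝ) ^ 6 * |(y : ℝ)| ^ 2 := by
      rw [hy]; push_cast
      rw [abs_mul, abs_of_nonneg (by positivity : (0 : ℝ) ≤ (g : ℝ) ^ 3)]; ring
    rw [h]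
    exact key _ 2 _ (abs_nonneg _) hHy' (by rw [hedef]; push_cast; linarith) (by norm_num)
  have hKN : 0 ≤ K * N' ^ e := by positivity
  have hΔle : |(Δ : ℝ)| ≤ 2 * K * N' ^ e := by
    have hrel' : (1728 : ℝ) * Δ = (c₄ : ℝ) ^ 3 - (c₆ : ℝ) ^ 2 := by exact_mod_cast hrel
    calc |(Δ : ℝ)| ≤ |(1728 : ℝ) * Δ| := by
          rw [abs_mul]
          exact le_mul_of_one_le_left (abs_nonneg _) (by norm_num)
      _ = |(c₄ : ℝ) ^ 3 - (c₆ : ℝ) ^ 2| := by rw [hrel']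
      _ ≤ |(c₄ : ℝ) ^ 3| + |(c₆ : ℝ) ^ 2| := abs_sub _ _
      _ = |(c₄ : ℝ)| ^ 3 + |(c₆ : ℝ)| ^ 2 := by rw [abs_pow, abs_pow]
      _ ≤ K * N' ^ e + K * N' ^ e := add_le_add hc₄3 hc₆2
      _ = 2 * K * N' ^ e := by ring
  -- conclusion
  rw [Int.cast_max, Int.cast_pow, Int.cast_abs, Int.cast_abs]
  refine max_le hΔle (hc₄3.trans ?_)
  linarith

end Literature.NumberTheory.EllipticCurves
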